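import Summits.BirchSwinnertonDyer.BirchSwinnertonDyer.Theorems.GenusKolyvaginAtTwoGenusPrimitiveSupplyAtTwoPosDiscShallowKFourPosSelmerCountExact
import Summits.BirchSwinnertonDyer.BirchSwinnertonDyer.Theorems.GenusKolyvaginAtTwoGenusDeepSupplyAtTwoNegDiscNarrowKFourCellSelmerCountCurrency
import Summits.BirchSwinnertonDyer.BirchSwinnertonDyer.Theorems.GenusKolyvaginAtTwoGenusDeepSupplyAtTwoNegDiscNarrowKFourCellLeafCurrency
import Summits.BirchSwinnertonDyer.BirchSwinnertonDyer.Theorems.GenusKolyvaginAtTwoSupplyKernelsLossless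
import HarnessLib

/-!
# Route `GenusKolyvaginAtTwo`, crux K₄⁺ `K4Pos` (stmt-BirchSwinnertonDyer-31469) — K₄⁺ IN LEAF CURRENCY AND «BSD₂(E) IS ONE DESCENT COUNT»:
# per curve on the cut, given the twin's `BSD₂`, PRINT and Q2:  K4Pos-at-`E` ⟺ `BSDp W 2` ⟺ `#Sel_(2^M₀)(E/ℚ) = 4^(M₀)` (K₄ twin alike)

Width seat `bsd-line-gk2-p5` g37 (cell `bsd-f1-sign2`), `--supports stmt-BirchSwinnertonDyer-31469 --as helper`; the Δ>0 twin of LEAD gk2-p1 g24's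
`KFourCell.LeafCurrency.kFourNeg_conclusion_iff_bsdp` (p774617), composed with this seat's Selmer-count currency (p774760 ★★, p774868 ★).  THEOREMS ONLY
(no definition, no named fact, no `sorry`); standard axioms.  **BSD is NOT proved by this file; nothing is closed; every theorem is CONDITIONAL on
`BSDp Wd 2` for the rank-one twin (an instance of U₂ `MinimalTwinBSDTwo`, stmt-22985), on the route's PRINT items (`GrossZagierAllLevels`,
`EntireLFunctionRat`, `MultPublishedInputsAtTwo`, `MilneAnyModel`) and on Q2 (`KolyvaginRelationAtTwo`).**

* §1 `kFourPos_conclusion_iff_bsdp` — on K4Pos's cut frame: **K4Pos's conclusion at `E` ↔ `BSDp W 2`** (→: Kolyvagin exactness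
  `kolyvaginExactAtTwoPosDiscT_proof` (`#Ш(E/K)[2^∞] = 4^(M₀)`) feeds the closed item `ExactDescentAtTwo` (24238); ←: `BSD₂` of the pair gives
  `#Ш(E/K)[2^∞] = 4^(M₀)` (g34 `Lossless.natCard_primaryComponent_sha_baseChange_two_eq_pow_of_bsdp_pair`), g36's «exactness ⟹ B₂ sharp»
  (`exists_mem_sha_two_pow_pred_smul_ne_zero_of_natCard_eq_pow`) and B2Q♭ give the witness).
* §2 `bsdp_iff_natCard_selmerGroup_eq_pow_of_kFourPos_cut` — **`BSDp W 2 ↔ #Sel_(2^M₀)(E/ℚ) = 4^(M₀)`** on the same frame: the `2`-part of BSD for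
  the rank-`0` member of the Heegner pair IS one `2^(M₀)`-descent count over `ℚ` (given the twin's `BSD₂`); depth two: `BSDp W 2 ↔ #Sel₄(E/ℚ) = 16`.
* §3 `bsdp_iff_natCard_selmerGroup_eq_pow_of_kFourNeg_cut` — the K₄ cell (Δ<0): the same over LEAD's p774617 and this seat's p774868.
READING: the crux kernels K₄/K₄⁺ at depth `≥ 2`, `BSD₂(E)` and «`#Sel_(2^M₀)(E/ℚ) = 4^(M₀)`» are ONE statement per curve on the cut (given U₂ for the
twin); the last form is decidable by a finite computation for each curve.  None of the three is proved here.  BSD is NOT proved by any of this.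

References: [McCallumLMS1991] §5 Thm. 5.4; [Kolyvagin1991MathAnn] Thm. 1; [GrossZagier1986] V.§2 (2.2); [Milne1972ArithmeticAV] §1 Thm. 1;
[Kramer1981] Thm. 1; [SilvermanAEC2009] Thm. X.4.2.
-/

set_option autoImplicit false
-- the Theorems namespace of this sub repeats the summit name by design (D-0017 nested layout)
set_option linter.dupNamespace false

noncomputable section

open scoped Classical
open scoped AddSubgroup

namespace Summit.BirchSwinnertonDyer.BirchSwinnertonDyer.Theorems.GenusExact.PlusDescent

open WeierstrassCurve NumberField IsDedekindDomain Field Literature.NumberTheory.EllipticCurves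
  Literature.NumberTheory.GaloisRepresentations Literature.NumberTheory.EllipticCurves.ModularForms AddSubgroup
  Literature.NumberTheory.EllipticCurves.RingClassField
open Summit.BirchSwinnertonDyer.BirchSwinnertonDyer.Theses.GenusKolyvaginAtTwo
  (KolyvaginRelationAtTwo GrossZagierAllLevels EntireLFunctionRat MultPublishedInputsAtTwo MilneAnyModel ExactDescentAtTwo)
open Summit.BirchSwinnertonDyer.BirchSwinnertonDyer.Theorems.GenusSupplyNarrow
open Summit.BirchSwinnertonDyer.BirchSwinnertonDyer.Theorems.GenusSupplyNarrow.KFourCell.LeafCurrency (kFourNeg_conclusion_iff_bsdp)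

/-! ## §1 The K₄⁺ cell on the cut: K4Pos-at-`E` ⟺ `BSD₂(E)` -/

/-- **K₄⁺ IN LEAF CURRENCY, per curve.**  On K4Pos's frame restricted to the cut (non-CM `E/ℚ` globally minimal, `r_an = 0`, `ρ_{E,2^n}` onto, odd
Tamagawa, `Δ > 0`, an odd multiplicative prime `v`; `K` imaginary quadratic, `d_K` odd `≠ −3`, Heegner, the two B₂ non-squares; an odd-Manin `Dt`; `d₁` with
`P(1)` of infinite order, `2^(M₀) ∥ P(1)`, `M₀ ≥ 1`; a globally minimal twin `Wd ≅ E^(d_K)` of analytic rank `1` with `#Sel₂(Wd) = 2`, `ord₂ C(Wd) = 0`),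
GIVEN `BSDp Wd 2`, the four PRINT items and Q2: **K4Pos's conclusion at `E` ↔ `BSDp W 2`**.  CONDITIONAL; BSD is NOT proved by this; K4Pos is NOT
proved by this — the theorem says the beyond-print kernel K₄⁺ is, curve by curve on the cut, `BSD₂(E)` for the rank-`0` member given `BSD₂(E^(d_K))`.
[cite: McCallumLMS1991, §5 Thm. 5.4] [cite: GrossZagier1986, V.§2 (2.2)] [cite: Milne1972ArithmeticAV, §1 Thm. 1] [cite: Kramer1981, Thm. 1] -/
theorem kFourPos_conclusion_iff_bsdp
    (hGZ : GrossZagierAllLevels) (hL : EntireLFunctionRat) (hGZK : MultPublishedInputsAtTwo) (hMi : MilneAnyModel) (hQ2 : KolyvaginRelationAtTwo)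
    (W : WeierstrassCurve ℚ) [W.IsElliptic] [W.IsGloballyMinimal] [NeZero (W.conductorNorm ℤ)] (hcm : ¬ W.HasCM) (hr0 : W.analyticRank = 0)
    (hρ : ∀ n : ℕ, 0 < n → W.HasSurjectiveModNGaloisRep ((2 : ℤ) ^ n)) (hT : Odd W.tamagawaProduct) (hΔ : 0 < W.Δ)
    (v : HeightOneSpectrum (𝓞 ℚ)) (h2v : ((2 : ℕ) : 𝓞 ℚ) ∉ v.asIdeal) (hNv : ((W.conductorNorm ℤ : ℕ) : 𝓞 ℚ) ∈ v.asIdeal)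
    (hmult : W.HasMultiplicativeReductionAt v)
    (K : Type) [Field K] [NumberField K] (hIQ : IsImaginaryQuadratic K) (hodd : Odd (NumberField.discr K))
    (h3 : NumberField.discr K ≠ -3) (hHe : SatisfiesHeegnerHypothesis (W.conductorNorm ℤ) K)
    (hsq1 : ¬ IsSquare ((NumberField.discr K : ℚ) * -|W.Δ|)) (hsq2 : ¬ IsSquare ((NumberField.discr K : ℚ) * (-(2 * |W.Δ|))))
    (Dt : ModularParametrizationData W (W.conductorNorm ℤ))
    (hopt : ∀ z ∈ Dt.L.lattice, ∃ w ∈ periodLattice Dt.f, z = (Dt.c : ℂ) * w) (hc : Odd Dt.c)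
    (β : ℤ) (ι : K →+* ℂ) (d₁ : KolyvaginHeegnerData Dt β ι 1) (hy : ¬ IsOfFinAddOrder d₁.derivedPoint) (M₀ : ℕ) (hM₀ : 1 ≤ M₀)
    (hdiv : ∃ Q : (W.baseChange (ringClassField K ι 1)).toAffine.Point, ((2 ^ M₀ : ℕ) : ℤ) • Q = d₁.derivedPoint)
    (hndiv : ¬ ∃ Q : (W.baseChange (ringClassField K ι 1)).toAffine.Point, ((2 ^ (M₀ + 1) : ℕ) : ℤ) • Q = d₁.derivedPoint)
    (Wd : WeierstrassCurve ℚ) [Wd.IsElliptic] [Wd.IsGloballyMinimal]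
    (hWd : ∃ C : VariableChange ℚ, C • W.quadraticTwist (NumberField.discr K : ℚ) = Wd) (hrd : Wd.analyticRank = 1)
    (hSel : Nat.card (Wd.selmerGroup 2) = 2) (hTam : padicValNat 2 Wd.tamagawaProduct = 0) (hBd : BSDp Wd 2) :
    (∃ (n : ℕ) (d : KolyvaginHeegnerData Dt β ι n), Squarefree n ∧
      (∀ ℓ ∈ n.primeFactors, Zhang2014.IsKolyvaginPrime (W.conductorNorm ℤ) W K 2 ℓ ∧ 2 ≤ Zhang2014.kolyvaginIndex W 2 ℓ ∧
        ∃ (v : HeightOneSpectrum (𝓞 ℚ)) (𝔓 : Ideal (absIntegers (𝓞 ℚ) ℚ)) (h : absoluteGaloisGroup ℚ),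
          ((ℓ : ℕ) : 𝓞 ℚ) ∈ v.asIdeal ∧ 𝔓 ∈ v.primesAbove ∧ IsArithFrobAt (𝓞 ℚ) h 𝔓 ∧ ∃ u : W.geomTorsion ((2 : ℕ) : ℤ), h • u ≠ u) ∧
      ¬ ∃ Q : (W.baseChange (ringClassField K ι n)).toAffine.Point, (2 : ℤ) • Q = d.derivedPoint) ↔
    BSDp W 2 := by
  haveI : Fact (Nat.Prime 2) := ⟨Nat.prime_two⟩
  have hs2 : W.HasSurjectiveModNGaloisRep 2 := by simpa using hρ 1 one_pos
  have hw : W.rootNumber = 1 :=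
    (Literature.Barriers.BirchSwinnertonDyer.even_analyticRank_iff_of_isNewformOf_conductorLevel Dt.isNewformOf).mp
      (by rw [hr0]; exact Even.zero)
  have hrk0 : W.mordellWeilRank = 0 := by rw [(hGZK W (by rw [hr0]; exact zero_le_one)).1, hr0]
  have hG : ExactDescentAtTwo := GenusExactDescent.exactDescentAtTwoOfFourFacts_proof ⟨hGZ, hGZK, hL, hMi⟩
  constructor
  · rintro ⟨n, d, hn, hprimes, hwit⟩
    -- Kolyvagin exactness on the Δ>0 cut, then the quadratic `2`-descent of exactness (item 24238, closed)
    have hSha : Nat.card (AddCommGroup.primaryComponent (W.baseChange K).sha 2) = 2 ^ (2 * M₀) :=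
      Summit.BirchSwinnertonDyer.BirchSwinnertonDyer.Theorems.kolyvaginExactAtTwoPosDiscT_proof hQ2 W hcm hT v h2v hNv hmult hΔ K hIQ hodd h3
        hHe hsq1 hsq2 hρ Dt β ι d₁ hy M₀ hdiv hndiv hw Wd hWd hSel hTam n d hn hprimes hwit
    exact hG W hcm hr0 hρ hT K hIQ hodd h3 hHe Dt hopt hc β ι d₁ hy M₀ hdiv hndiv hSha Wd hWd hSel hBd
  · intro hBW
    -- `BSD₂` of the pair ⟹ `#Ш(E/K)[2^∞] = 4^(M₀)` ⟹ a class of `Ш(E/ℚ)` not killed by `2^(M₀−1)` ⟹ B2Q♭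
    have hpow := Lossless.natCard_primaryComponent_sha_baseChange_two_eq_pow_of_bsdp_pair hGZ hL hGZK hMi W hs2 hT hr0 K hIQ hodd h3 hHe Dt
      hc β ι d₁ M₀ hdiv hndiv Wd hWd hrd hBW hBd
    obtain ⟨k, a, ha, hka, hne⟩ := exists_mem_sha_two_pow_pred_smul_ne_zero_of_natCard_eq_pow W K hT hIQ hodd hHe hs2 Dt β ι d₁ hy M₀ hM₀
      hndiv hw hrk0 Wd hWd hSel (Or.inr ⟨hΔ, hTam⟩) hpow
    exact kFourPos_shape_of_mem_sha_rat_of_two_pow_pred_smul_ne_zero hQ2 W hcm hT v h2v hNv hmult K hIQ hodd h3 hHe hsq1 hsq2 hρ Dt β ι d₁ M₀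
      hndiv hw k a ha hka hne

/-! ## §2 `BSD₂(E)` IS ONE DESCENT COUNT on the K₄⁺ cut cell -/

/-- **`BSDp W 2 ↔ #Sel_(2^M₀)(E/ℚ) = 4^(M₀)`** on K4Pos's cut frame with the cell's `#Sel₂(E) = 4` (same binders as §1), GIVEN `BSDp Wd 2`, PRINT and Q2:
§1 composed with this seat's ★★ `kFourPos_shape_iff_natCard_selmerGroup_eq_pow` (p774760).  So, for the rank-`0` member of a Δ>0 Heegner pair on the
cut, the `2`-part of BSD is EQUIVALENT to one `2^(M₀)`-descent count over `ℚ` (once the rank-`1` twin's `BSD₂` is known — U₂).  CONDITIONAL; BSD is NOT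
proved by this. [cite: McCallumLMS1991, §5 Thm. 5.4] [cite: GrossZagier1986, V.§2 (2.2)] [cite: SilvermanAEC2009, Thm. X.4.2] -/
theorem bsdp_iff_natCard_selmerGroup_eq_pow_of_kFourPos_cut
    (hGZ : GrossZagierAllLevels) (hL : EntireLFunctionRat) (hGZK : MultPublishedInputsAtTwo) (hMi : MilneAnyModel) (hQ2 : KolyvaginRelationAtTwo)
    (W : WeierstrassCurve ℚ) [W.IsElliptic] [W.IsGloballyMinimal] [NeZero (W.conductorNorm ℤ)] (hcm : ¬ W.HasCM) (hr0 : W.analyticRank = 0)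
    (hρ : ∀ n : ℕ, 0 < n → W.HasSurjectiveModNGaloisRep ((2 : ℤ) ^ n)) (hT : Odd W.tamagawaProduct) (hΔ : 0 < W.Δ)
    (hSel4 : Nat.card (W.selmerGroup 2) = 4)
    (v : HeightOneSpectrum (𝓞 ℚ)) (h2v : ((2 : ℕ) : 𝓞 ℚ) ∉ v.asIdeal) (hNv : ((W.conductorNorm ℤ : ℕ) : 𝓞 ℚ) ∈ v.asIdeal)
    (hmult : W.HasMultiplicativeReductionAt v)
    (K : Type) [Field K] [NumberField K] (hIQ : IsImaginaryQuadratic K) (hodd : Odd (NumberField.discr K))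
    (h3 : NumberField.discr K ≠ -3) (hHe : SatisfiesHeegnerHypothesis (W.conductorNorm ℤ) K)
    (hsq1 : ¬ IsSquare ((NumberField.discr K : ℚ) * -|W.Δ|)) (hsq2 : ¬ IsSquare ((NumberField.discr K : ℚ) * (-(2 * |W.Δ|))))
    (Dt : ModularParametrizationData W (W.conductorNorm ℤ))
    (hopt : ∀ z ∈ Dt.L.lattice, ∃ w ∈ periodLattice Dt.f, z = (Dt.c : ℂ) * w) (hc : Odd Dt.c)
    (β : ℤ) (ι : K →+* ℂ) (d₁ : KolyvaginHeegnerData Dt β ι 1) (hy : ¬ IsOfFinAddOrder d₁.derivedPoint) (M₀ : ℕ) (hM₀ : 1 ≤ M₀)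
    (hdiv : ∃ Q : (W.baseChange (ringClassField K ι 1)).toAffine.Point, ((2 ^ M₀ : ℕ) : ℤ) • Q = d₁.derivedPoint)
    (hndiv : ¬ ∃ Q : (W.baseChange (ringClassField K ι 1)).toAffine.Point, ((2 ^ (M₀ + 1) : ℕ) : ℤ) • Q = d₁.derivedPoint)
    (Wd : WeierstrassCurve ℚ) [Wd.IsElliptic] [Wd.IsGloballyMinimal]
    (hWd : ∃ C : VariableChange ℚ, C • W.quadraticTwist (NumberField.discr K : ℚ) = Wd) (hrd : Wd.analyticRank = 1)
    (hSel : Nat.card (Wd.selmerGroup 2) = 2) (hTam : padicValNat 2 Wd.tamagawaProduct = 0) (hBd : BSDp Wd 2) :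
    BSDp W 2 ↔ Nat.card (W.selmerGroup ((2 ^ M₀ : ℕ) : ℤ)) = 4 ^ M₀ := by
  rw [← kFourPos_conclusion_iff_bsdp hGZ hL hGZK hMi hQ2 W hcm hr0 hρ hT hΔ v h2v hNv hmult K hIQ hodd h3 hHe hsq1 hsq2 Dt hopt hc β ι d₁ hy M₀ hM₀
    hdiv hndiv Wd hWd hrd hSel hTam hBd]
  exact kFourPos_shape_iff_natCard_selmerGroup_eq_pow hQ2 hGZK W hcm hr0 hρ hT hΔ hSel4 v h2v hNv hmult K hIQ hodd h3 hHe hsq1 hsq2 Dt β ι d₁ hy M₀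
    hM₀ hdiv hndiv Wd hWd hSel hTam

/-- **DEPTH TWO: `BSDp W 2 ↔ #Sel₄(E/ℚ) = 16`** on the `M₀ = 2` K₄⁺ cut cell, GIVEN `BSDp Wd 2`, PRINT and Q2 — the `2`-part of BSD for `E` is one
`4`-descent count.  CONDITIONAL; BSD is NOT proved by this. [cite: McCallumLMS1991, §5 Thm. 5.4] [cite: SilvermanAEC2009, Thm. X.4.2] -/
theorem bsdp_iff_natCard_selmerGroup_four_eq_sixteen_of_kFourPos_cut
    (hGZ : GrossZagierAllLevels) (hL : EntireLFunctionRat) (hGZK : MultPublishedInputsAtTwo) (hMi : MilneAnyModel) (hQ2 : KolyvaginRelationAtTwo)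
    (W : WeierstrassCurve ℚ) [W.IsElliptic] [W.IsGloballyMinimal] [NeZero (W.conductorNorm ℤ)] (hcm : ¬ W.HasCM) (hr0 : W.analyticRank = 0)
    (hρ : ∀ n : ℕ, 0 < n → W.HasSurjectiveModNGaloisRep ((2 : ℤ) ^ n)) (hT : Odd W.tamagawaProduct) (hΔ : 0 < W.Δ)
    (hSel4 : Nat.card (W.selmerGroup 2) = 4)
    (v : HeightOneSpectrum (𝓞 ℚ)) (h2v : ((2 : ℕ) : 𝓞 ℚ) ∉ v.asIdeal) (hNv : ((W.conductorNorm ℤ : ℕ) : 𝓞 ℚ) ∈ v.asIdeal)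
    (hmult : W.HasMultiplicativeReductionAt v)
    (K : Type) [Field K] [NumberField K] (hIQ : IsImaginaryQuadratic K) (hodd : Odd (NumberField.discr K))
    (h3 : NumberField.discr K ≠ -3) (hHe : SatisfiesHeegnerHypothesis (W.conductorNorm ℤ) K)
    (hsq1 : ¬ IsSquare ((NumberField.discr K : ℚ) * -|W.Δ|)) (hsq2 : ¬ IsSquare ((NumberField.discr K : ℚ) * (-(2 * |W.Δ|))))
    (Dt : ModularParametrizationData W (W.conductorNorm ℤ))
    (hopt : ∀ z ∈ Dt.L.lattice, ∃ w ∈ periodLattice Dt.f, z = (Dt.c : ℂ) * w) (hc : Odd Dt.c)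
    (β : ℤ) (ι : K →+* ℂ) (d₁ : KolyvaginHeegnerData Dt β ι 1) (hy : ¬ IsOfFinAddOrder d₁.derivedPoint)
    (hdiv : ∃ Q : (W.baseChange (ringClassField K ι 1)).toAffine.Point, ((2 ^ 2 : ℕ) : ℤ) • Q = d₁.derivedPoint)
    (hndiv : ¬ ∃ Q : (W.baseChange (ringClassField K ι 1)).toAffine.Point, ((2 ^ (2 + 1) : ℕ) : ℤ) • Q = d₁.derivedPoint)
    (Wd : WeierstrassCurve ℚ) [Wd.IsElliptic] [Wd.IsGloballyMinimal]
    (hWd : ∃ C : VariableChange ℚ, C • W.quadraticTwist (NumberField.discr K : ℚ) = Wd) (hrd : Wd.analyticRank = 1)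
    (hSel : Nat.card (Wd.selmerGroup 2) = 2) (hTam : padicValNat 2 Wd.tamagawaProduct = 0) (hBd : BSDp Wd 2) :
    BSDp W 2 ↔ Nat.card (W.selmerGroup 4) = 16 := by
  have h := bsdp_iff_natCard_selmerGroup_eq_pow_of_kFourPos_cut hGZ hL hGZK hMi hQ2 W hcm hr0 hρ hT hΔ hSel4 v h2v hNv hmult K hIQ hodd h3 hHe hsq1
    hsq2 Dt hopt hc β ι d₁ hy 2 (by norm_num) hdiv hndiv Wd hWd hrd hSel hTam hBd
  have e4 : ((2 ^ 2 : ℕ) : ℤ) = 4 := by norm_num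
  have e16 : (4 : ℕ) ^ 2 = 16 := by norm_num
  rw [e4, e16] at h
  exact h

/-! ## §3 The K₄ cell (Δ < 0): `BSD₂(E)` IS ONE DESCENT COUNT -/

/-- **`BSDp W 2 ↔ #Sel_(2^M₀)(E/ℚ) = 4^(M₀)` on the K₄ cut cell (Δ < 0)** — LEAD gk2-p1 g24's `kFourNeg_conclusion_iff_bsdp` (p774617, binders VERBATIM)
composed with this seat's ★ `kFourNeg_conclusion_iff_natCard_selmerGroup_eq_pow` (p774868).  GIVEN `BSDp Wd 2`, PRINT and Q2.  CONDITIONAL; BSD is NOT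
proved by this. [cite: McCallumLMS1991, §5 Thm. 5.4] [cite: Kolyvagin1991MathAnn, Thm. 1] [cite: GrossZagier1986, V.§2 (2.2)] [cite: SilvermanAEC2009, Thm. X.4.2] -/
theorem bsdp_iff_natCard_selmerGroup_eq_pow_of_kFourNeg_cut
    (hGZ : GrossZagierAllLevels) (hL : EntireLFunctionRat) (hGZK : MultPublishedInputsAtTwo) (hMi : MilneAnyModel) (hQ2 : KolyvaginRelationAtTwo)
    (W : WeierstrassCurve ℚ) [W.IsElliptic] [W.IsGloballyMinimal] [NeZero (W.conductorNorm ℤ)] (hcm : ¬ W.HasCM)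
    (hr0 : W.analyticRank = 0) (hρ : ∀ n : ℕ, 0 < n → W.HasSurjectiveModNGaloisRep ((2 : ℤ) ^ n)) (hT : Odd W.tamagawaProduct)
    (hneg : W.Δ < 0) (h4 : Nat.card (W.selmerGroup 2) = 4)
    (K : Type) [Field K] [NumberField K] (hIQ : IsImaginaryQuadratic K) (hodd : Odd (NumberField.discr K))
    (h3 : NumberField.discr K ≠ -3) (hHe : SatisfiesHeegnerHypothesis (W.conductorNorm ℤ) K)
    (hsq1 : ¬ IsSquare ((NumberField.discr K : ℚ) * -|W.Δ|)) (hsq2 : ¬ IsSquare ((NumberField.discr K : ℚ) * (-(2 * |W.Δ|))))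
    (ℓ₀ : ℕ) (hℓ₀ : ℓ₀.Prime) (hdK : NumberField.discr K = -(ℓ₀ : ℤ))
    (h2K : ((Ideal.span {(2 : ℤ)}).primesOver (𝓞 K)).ncard = 2)
    (Dt : ModularParametrizationData W (W.conductorNorm ℤ))
    (hopt : ∀ z ∈ Dt.L.lattice, ∃ w ∈ periodLattice Dt.f, z = (Dt.c : ℂ) * w) (hc : Odd Dt.c)
    (β : ℤ) (ι : K →+* ℂ) (d₁ : KolyvaginHeegnerData Dt β ι 1) (hy : ¬ IsOfFinAddOrder d₁.derivedPoint) (M₀ : ℕ)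
    (hdiv : ∃ Q : (W.baseChange (ringClassField K ι 1)).toAffine.Point, ((2 ^ M₀ : ℕ) : ℤ) • Q = d₁.derivedPoint)
    (hndiv : ¬ ∃ Q : (W.baseChange (ringClassField K ι 1)).toAffine.Point, ((2 ^ (M₀ + 1) : ℕ) : ℤ) • Q = d₁.derivedPoint)
    (hM₀ : 1 ≤ M₀) (Wd : WeierstrassCurve ℚ) [Wd.IsElliptic] [Wd.IsGloballyMinimal]
    (hWd : ∃ C : VariableChange ℚ, C • W.quadraticTwist (NumberField.discr K : ℚ) = Wd) (hrd : Wd.analyticRank = 1)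
    (hSel : Nat.card (Wd.selmerGroup 2) = 2) (hDEF : padicValNat 2 Wd.tamagawaProduct ≤ 1)
    (v : HeightOneSpectrum (𝓞 ℚ)) (h2v : ((2 : ℕ) : 𝓞 ℚ) ∉ v.asIdeal) (hNv : ((W.conductorNorm ℤ : ℕ) : 𝓞 ℚ) ∈ v.asIdeal)
    (hmult : W.HasMultiplicativeReductionAt v) (hBd : BSDp Wd 2) :
    BSDp W 2 ↔ Nat.card (W.selmerGroup ((2 ^ M₀ : ℕ) : ℤ)) = 4 ^ M₀ := by
  rw [← kFourNeg_conclusion_iff_bsdp hGZ hL hGZK hMi hQ2 W hcm hr0 hρ hT hneg h4 K hIQ hodd h3 hHe hsq1 hsq2 ℓ₀ hℓ₀ hdK h2K Dt hopt hc β ι d₁ hy M₀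
    hdiv hndiv hM₀ Wd hWd hrd hSel hDEF v h2v hNv hmult hBd]
  exact kFourNeg_conclusion_iff_natCard_selmerGroup_eq_pow hQ2 W hcm hr0 hρ hT hneg h4 K hIQ hodd h3 hHe hsq1 hsq2 ℓ₀ hℓ₀ hdK h2K Dt hopt hc β ι d₁
    hy M₀ hdiv hndiv hM₀ Wd hWd hrd hSel hDEF v h2v hNv hmult

end Summit.BirchSwinnertonDyer.BirchSwinnertonDyer.Theorems.GenusExact.PlusDescent

end
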